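import Mathlib
import Summits.QuantumFields.YangMills.Theorems.CoarseStiffnessTailCappedCoarseStiffnessLBareCompactCoupling
import Summits.QuantumFields.YangMills.Theorems.CoarseStiffnessTailCappedCoarseStiffnessLCornerCombBound
import Summits.QuantumFields.YangMills.Theorems.CoarseStiffnessTailCappedCoarseStiffnessLAbelianFlatLowerBound
import Summits.QuantumFields.YangMills.Theorems.BalabanUVNodesN13WilsonPartitionFnGaussianUpperBoundSU

/-!
# Route `CoarseStiffnessTail` — THE TORUS PARTITION SANDWICH WITH TOTAL SLACK `O(|T| + log β)`, AND THE BARE FACES OF THE CRUX / THE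
# UNIFORM MEAN ACTION OUTSIDE THE HYPER-WEAK CORNER (lead's certificate, seat `ym-line-cst-p1` g15; helper on 25301, stub S3)

§1 THE RATIO (`log_partitionFn_ratio_le_sharp`, `G = SU(N)`, EVERY `Params` — any `d`, `L`, `m`, `K` — `1 ≤ β`, `0 < β'`):

  `log Z_P(β') − log Z_P(β) ≤ a(d−1)|T|·(log β − log β') + a(d−1)·log β' + E·d²·|T|`,   `a = (N²−1)/2`,

the corner-comb UPPER bound (`…LCornerCombBound.log_partitionFn_le_cornerComb`: `(d−1)(|T|−1)` Gaussian factors at `β'`) minus the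
abelian-flat LOWER bound (`…LAbelianFlatLowerBound`: `(d−1)|T|` Gaussian factors at `β`).  The only `β`-dependence left beyond `log(β/β')`
is the SINGLE term `a(d−1)·log β'` — the tree's `…LTorusPartitionRatio` (N13 sandwich) had `a·d·(|T|/n)·log β`.
§2 ON BAŁABAN's THREE-TORI (`SU(2)`, `a(d−1) = 3`): for all `F`, `0 < γ ≤ 1`, `K`, `0 ≤ c₀ ≤ 1/8`, ONE absolute `A`:
* ★ `exists_bareStiffness_le_logSlack`: `∫ exp(c₀·β_K·Σ_a|U(∂a) − 1|²) dGibbs_K ≤ exp(A·#Plaq_0 + 3·log β_K)` — TOTAL slack `3 log β_K`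
  (g14: `(3/2)(#Plaq_0/n_K)·log β_K = 18 L^{2(m+K)} log β_K`);
* ★ `exists_crux0_le_logSlack` / `exists_bulk0_le_logSlack` (the `j = 0` faces of the crux and of the BULK stub, every profile);
* ★ `exists_meanSqSum_le_logSlack`: `β_K·∫Σ_a|U(∂a) − 1|² dGibbs_K ≤ 8A·#Plaq_0 + 24·log β_K`.
§3 OUTSIDE THE HYPER-WEAK CORNER `log β_K ≤ #Plaq_0` (i.e. `K log L + log γ⁻¹ ≤ 24·L^{3(m+K)}`): ★★ `crux0_of_log_le`, `bulk0_of_log_le`,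
`ubs_of_log_le`, `uma_of_log_le` — the bare faces and the UNIFORM MEAN ACTION with constants INDEPENDENT of `γ`, `K`, `m` (and of `L`),
hence in particular on every compact coupling range (g14) and along every continuum limit `K → ∞`; the residual of stub S3 is now only the
hyper-weak corner `log β_K > #Plaq_0` of a fixed lattice, where the missing input is the exact Laplace exponent `3|T| − 1` (the two free
global holonomy directions; line card §g15).

HONEST SCOPE.  Elementary: two landed partition bounds subtracted, convexity bookkeeping, Jensen.  Nothing of Bałaban's is asserted; the crux
25301 (S1, S2 and the hyper-weak corner of S3), `HistoryTailL` 19936 and every rung stay OPEN; `YM3TorusSU2` (R3, RECORD rung, not Clay) is NOT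
proved; the Yang–Mills mass gap is NOT touched.

References: T. Bałaban, CMP **102** (1985) 255–275 [Balaban1985UV3] ((1)–(3) p.256; (11) p.258); T. Bałaban, CMP **109** (1987) 249–301
[Balaban1987RG1] ((0.14) p.254); I. Montvay, G. Münster, *Quantum Fields on a Lattice* (1994) §3.2.5 [MontvayMunster1994].
-/

noncomputable section

namespace Summit.QuantumFields.YangMills.Theorems.CoarseStiffnessTailTotalLogSlack

open MeasureTheory ProbabilityTheory Finset
open Literature.MathematicalPhysics.QuantumFieldTheory
open Literature.MathematicalPhysics.QuantumFieldTheory.UnitaryCayley (haarChartConst)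
open Literature.MathematicalPhysics.QuantumFieldTheory.Balaban1983to89
open Literature.MathematicalPhysics.QuantumFieldTheory.Balaban1983to89.T3ContinuumYM3Torus
open Literature.MathematicalPhysics.QuantumFieldTheory.Balaban1983to89.T3UnitScaleTilt
open Literature.MathematicalPhysics.QuantumFieldTheory.Balaban1983to89.T3UnitLawDensityEML
open Literature.MathematicalPhysics.QuantumFieldTheory.Balaban1983to89.Missing
open Literature.MathematicalPhysics.QuantumFieldTheory.Balaban1983to89.T3UpperLiftSplit (scheme_β_eq)
open Summit.QuantumFields.BalabanUV.T4Continuum.NE7b.BarePartitionFnDecay (linkMass)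
open Summit.QuantumFields.YangMills.BalabanUVNodes.N13ZNormLaplaceUpperSU (one_le_DT)
open Summit.QuantumFields.YangMills.BalabanUVNodes.N13WilsonPartitionFnGaussianUpperBoundSU (log_linkMass_SU_le)
open Summit.QuantumFields.YangMills.Theorems.CoarseStiffnessTailPressureConvexity
open Summit.QuantumFields.YangMills.Theorems.CoarseStiffnessTailBareCompactCoupling (card_plaq_zero_eq integral_exp_dominated_le)
open Summit.QuantumFields.YangMills.Theorems.CoarseStiffnessTailCornerCombBound (log_partitionFn_le_cornerComb)
open Summit.QuantumFields.YangMills.Theorems.CoarseStiffnessTailAbelianFlatLowerBound (log_partitionFn_ge_abelianFlat_specialUnitary)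

/-! ## §1 The ratio with total slack `a(d−1)·log β' + O(|T|)` (`SU(N)`, every `Params`) -/

section Ratio

variable (N : ℕ) [NeZero N]

/-- **★ THE TORUS PARTITION RATIO WITH TOTAL LOGARITHMIC SLACK** (`G = SU(N)`, every `Params` `P`, `1 ≤ β`, `0 < β'`; no order between
`β` and `β'` is needed):
`log Z_P(β') − log Z_P(β) ≤ a(d−1)|T|·(log β − log β') + a(d−1)·log β' + ((d−1)·log(D_N T_N) + (d−1)·max(C_N,0) + 8d²)·|T|`,
`a = (N²−1)/2` — the corner-comb upper bound at `β'` minus the abelian-flat lower bound at `β`. [folklore] -/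
theorem log_partitionFn_ratio_le_sharp (P : Params) {β β' : ℝ} (hβ : 1 ≤ β) (hβ' : 0 < β') :
    Real.log (partitionFn (G := Matrix.specialUnitaryGroup (Fin N) ℂ) P β') -
        Real.log (partitionFn (G := Matrix.specialUnitaryGroup (Fin N) ℂ) P β) ≤
      (((N * N : ℕ) : ℝ) - 1) / 2 * ((P.d : ℝ) - 1) * (Fintype.card (Site P 0) : ℝ) * (Real.log β - Real.log β') +
        (((N * N : ℕ) : ℝ) - 1) / 2 * ((P.d : ℝ) - 1) * Real.log β' +
        (((P.d : ℝ) - 1) *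
              Real.log (max (Real.pi * (haarChartConst N : ℝ) * 5 ^ (N * N) *
                    (volume (Metric.closedBall (0 : EuclideanSpace ℝ (Fin N × Fin N)) 1)).toReal) (10 ^ (N * N - 1)) *
                  (∑' k : ℕ, ((k : ℝ) + 1) ^ (N * N - 1) * Real.exp (-(1 / (2 * (N : ℝ)))) ^ k)) +
            ((P.d : ℝ) - 1) * max (((N * N : ℕ) : ℝ) * Real.log (16 * Real.pi + 1) + Real.log ((2 * N + 1) / (4 * Real.pi))) 0 +
            8 * (P.d : ℝ) ^ 2) * (Fintype.card (Site P 0) : ℝ) := by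
  have hU1 := log_partitionFn_le_cornerComb P (G := Matrix.specialUnitaryGroup (Fin N) ℂ) hβ'.le
  have hU2 := log_linkMass_SU_le N hβ'
  have hL := log_partitionFn_ge_abelianFlat_specialUnitary N P hβ
  set a : ℝ := (((N * N : ℕ) : ℝ) - 1) / 2 with ha
  set D : ℝ := (P.d : ℝ) with hD
  set V : ℝ := (Fintype.card (Site P 0) : ℝ) with hV
  set LDT : ℝ := Real.log (max (Real.pi * (haarChartConst N : ℝ) * 5 ^ (N * N) *
        (volume (Metric.closedBall (0 : EuclideanSpace ℝ (Fin N × Fin N)) 1)).toReal) (10 ^ (N * N - 1)) *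
      (∑' k : ℕ, ((k : ℝ) + 1) ^ (N * N - 1) * Real.exp (-(1 / (2 * (N : ℝ)))) ^ k)) with hLDT
  set C : ℝ := ((N * N : ℕ) : ℝ) * Real.log (16 * Real.pi + 1) + Real.log ((2 * N + 1) / (4 * Real.pi)) with hC
  set lβ : ℝ := Real.log β with hlβ
  set lβ' : ℝ := Real.log β' with hlβ'
  set LM : ℝ := Real.log (linkMass (G := Matrix.specialUnitaryGroup (Fin N) ℂ) β') with hLM
  set LZ : ℝ := Real.log (partitionFn (G := Matrix.specialUnitaryGroup (Fin N) ℂ) P β) with hLZ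
  set LZ' : ℝ := Real.log (partitionFn (G := Matrix.specialUnitaryGroup (Fin N) ℂ) P β') with hLZ'
  have ha0 : 0 ≤ a := by
    have h1 : (1 : ℝ) ≤ ((N * N : ℕ) : ℝ) := by
      have : 1 ≤ N * N := Nat.one_le_iff_ne_zero.2 (Nat.mul_ne_zero (NeZero.ne N) (NeZero.ne N))
      exact_mod_cast this
    rw [ha]; linarith
  have hD1 : 1 ≤ D := by rw [hD]; exact_mod_cast P.hd
  have hV1 : 1 ≤ V := by rw [hV]; exact_mod_cast (Fintype.card_pos : 0 < Fintype.card (Site P 0))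
  have hLDT0 : 0 ≤ LDT := by rw [hLDT]; exact Real.log_nonneg one_le_DT
  have hCM : C ≤ max C 0 := le_max_left _ _
  have hM0 : 0 ≤ max C 0 := le_max_right _ _
  -- the upper bound at `β'`: `LZ' ≤ (D−1)(V−1)·LM ≤ (D−1)(V−1)(−a lβ' + LDT)`
  have hcoef : 0 ≤ (D - 1) * (V - 1) := mul_nonneg (by linarith) (by linarith)
  have hU : LZ' ≤ (D - 1) * (V - 1) * (-a * lβ' + LDT) := hU1.trans (mul_le_mul_of_nonneg_left hU2 hcoef)
  -- bookkeeping identity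
  have key : a * (D - 1) * V * (lβ - lβ') + a * (D - 1) * lβ' + ((D - 1) * LDT + (D - 1) * max C 0 + 8 * D ^ 2) * V -
      ((D - 1) * (V - 1) * (-a * lβ' + LDT) - (-((D - 1) * V) * (a * lβ + C) - 8 * D ^ 2 * V)) =
      (D - 1) * LDT + (D - 1) * V * (max C 0 - C) := by ring
  have t1 : 0 ≤ (D - 1) * LDT := mul_nonneg (by linarith) hLDT0
  have t2 : 0 ≤ (D - 1) * V * (max C 0 - C) := by
    have : 0 ≤ D - 1 := by linarith
    have : 0 ≤ max C 0 - C := by linarith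
    have : 0 ≤ V := by linarith
    positivity
  linarith [hU, hL, key, t1, t2]

/-- **∃-FORM**: `∃ E ≥ 0`, for every `Params` `P`, `1 ≤ β`, `0 < β'`:
`log Z_P(β') − log Z_P(β) ≤ a(d−1)|T|(log β − log β') + a(d−1) log β' + E·d²·|T|`. [folklore] -/
theorem exists_log_partitionFn_ratio_le_sharp :
    ∃ E : ℝ, 0 ≤ E ∧ ∀ (P : Params) (β β' : ℝ), 1 ≤ β → 0 < β' →
      Real.log (partitionFn (G := Matrix.specialUnitaryGroup (Fin N) ℂ) P β') -
          Real.log (partitionFn (G := Matrix.specialUnitaryGroup (Fin N) ℂ) P β) ≤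
        (((N * N : ℕ) : ℝ) - 1) / 2 * ((P.d : ℝ) - 1) * (Fintype.card (Site P 0) : ℝ) * (Real.log β - Real.log β') +
          (((N * N : ℕ) : ℝ) - 1) / 2 * ((P.d : ℝ) - 1) * Real.log β' +
          E * (P.d : ℝ) ^ 2 * (Fintype.card (Site P 0) : ℝ) := by
  set LDT : ℝ := Real.log (max (Real.pi * (haarChartConst N : ℝ) * 5 ^ (N * N) *
        (volume (Metric.closedBall (0 : EuclideanSpace ℝ (Fin N × Fin N)) 1)).toReal) (10 ^ (N * N - 1)) *
      (∑' k : ℕ, ((k : ℝ) + 1) ^ (N * N - 1) * Real.exp (-(1 / (2 * (N : ℝ)))) ^ k)) with hLDT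
  set C : ℝ := ((N * N : ℕ) : ℝ) * Real.log (16 * Real.pi + 1) + Real.log ((2 * N + 1) / (4 * Real.pi)) with hC
  have hLDT0 : 0 ≤ LDT := by rw [hLDT]; exact Real.log_nonneg one_le_DT
  have hM0 : 0 ≤ max C 0 := le_max_right _ _
  refine ⟨LDT + max C 0 + 8, by positivity, fun P β β' hβ hβ' => ?_⟩
  have h := log_partitionFn_ratio_le_sharp N P hβ hβ'
  rw [← hLDT, ← hC] at h
  have hD1 : (1 : ℝ) ≤ (P.d : ℝ) := by exact_mod_cast P.hd
  have hV0 : (0 : ℝ) ≤ (Fintype.card (Site P 0) : ℝ) := Nat.cast_nonneg _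
  have hE : (((P.d : ℝ) - 1) * LDT + ((P.d : ℝ) - 1) * max C 0 + 8 * (P.d : ℝ) ^ 2) * (Fintype.card (Site P 0) : ℝ) ≤
      (LDT + max C 0 + 8) * (P.d : ℝ) ^ 2 * (Fintype.card (Site P 0) : ℝ) := by
    have hd1 : (P.d : ℝ) - 1 ≤ (P.d : ℝ) ^ 2 := by nlinarith
    have h1 : ((P.d : ℝ) - 1) * LDT ≤ (P.d : ℝ) ^ 2 * LDT := mul_le_mul_of_nonneg_right hd1 hLDT0
    have h2 : ((P.d : ℝ) - 1) * max C 0 ≤ (P.d : ℝ) ^ 2 * max C 0 := mul_le_mul_of_nonneg_right hd1 hM0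
    have h3 : ((P.d : ℝ) - 1) * LDT + ((P.d : ℝ) - 1) * max C 0 + 8 * (P.d : ℝ) ^ 2 ≤ (LDT + max C 0 + 8) * (P.d : ℝ) ^ 2 := by
      nlinarith
    exact mul_le_mul_of_nonneg_right h3 hV0
  linarith

end Ratio

/-! ## §2 Bałaban's three-tori, `SU(2)`: the bare stiffness with TOTAL slack `3·log β_K` -/

section Bare

variable (F : T3Family)

/-- **★ THE UNCAPPED BARE STIFFNESS WITH TOTAL SLACK `3·log β_K`.**  One absolute constant `A` such that for every three-torus family `F`
(any `L`, any volume exponent `m`), every `0 < γ ≤ 1`, every cut-off `K` and every `0 ≤ c₀ ≤ 1/8`: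
`∫ exp(c₀·β_K·Σ_a |U(∂a) − 1|²) dGibbs_K ≤ exp(A·#Plaq_0 + 3·log β_K)`, `β_K = (γL^{−K})⁻¹`. [folklore] -/
theorem exists_bareStiffness_le_logSlack :
    ∃ A : ℝ, 0 ≤ A ∧ ∀ (F : T3Family) (γ : ℝ), 0 < γ → γ ≤ 1 → ∀ (K : ℕ) (c₀ : ℝ), 0 ≤ c₀ → c₀ ≤ 1 / 8 →
      ∫ U, Real.exp (c₀ * (γ * ((F.L : ℝ)⁻¹) ^ K)⁻¹ * ∑ a : Plaq (F.P K) 0, dist1 (GaugeField.plaqHol U a) ^ 2) ∂(gibbsK F ℰp γ K) ≤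
        Real.exp (A * (Fintype.card (Plaq (F.P K) 0) : ℝ) + 3 * Real.log (γ * ((F.L : ℝ)⁻¹) ^ K)⁻¹) := by
  obtain ⟨E, hE0, hE⟩ := exists_log_partitionFn_ratio_le_sharp 2
  refine ⟨Real.log 2 + 3 * E, by positivity, fun F γ hγ hγ1 K c₀ hc₀ hc₀' => ?_⟩
  set β : ℝ := (γ * ((F.L : ℝ)⁻¹) ^ K)⁻¹ with hβdef
  set nP : ℝ := (Fintype.card (Plaq (F.P K) 0) : ℝ) with hnP
  have hβ1 : 1 ≤ β := by
    have hL1 : (1 : ℝ) ≤ F.L := by exact_mod_cast F.hL.2.le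
    have hx0 : 0 < ((F.L : ℝ)⁻¹) ^ K := pow_pos (inv_pos.2 (by linarith)) K
    have hx : ((F.L : ℝ)⁻¹) ^ K ≤ 1 := pow_le_one₀ (inv_nonneg.2 (by linarith)) (inv_le_one_of_one_le₀ hL1)
    exact (one_le_inv₀ (mul_pos hγ hx0)).2 (by nlinarith)
  have hβ0 : 0 < β := lt_of_lt_of_le one_pos hβ1
  haveI := isProbabilityMeasure_gibbsK F ℰp hγ.le K
  have hnP3 : nP = 3 * (Fintype.card (Site (F.P K) 0) : ℝ) := card_plaq_zero_eq F K
  have hV0 : (0 : ℝ) ≤ (Fintype.card (Site (F.P K) 0) : ℝ) := Nat.cast_nonneg _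
  -- Step 1: pointwise `exp(c₀βΣd²) ≤ exp((4c₀β)·A)`
  set t : ℝ := 4 * c₀ * β with ht
  have ht0 : 0 ≤ t := by positivity
  have htβ : t ≤ β / 2 := by rw [ht]; nlinarith
  have hpt : ∀ U : GaugeField (F.P K) 0 (Matrix.specialUnitaryGroup (Fin 2) ℂ),
      Real.exp (c₀ * β * ∑ a : Plaq (F.P K) 0, dist1 (GaugeField.plaqHol U a) ^ 2) ≤ Real.exp (t * wilsonAction4 U) := fun U => by
    refine Real.exp_le_exp.mpr ?_
    have h4 := sqSum_le_four_mul_action F U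
    have hcb : 0 ≤ c₀ * β := by positivity
    calc c₀ * β * ∑ a : Plaq (F.P K) 0, dist1 (GaugeField.plaqHol U a) ^ 2 ≤ c₀ * β * (4 * wilsonAction4 U) :=
          mul_le_mul_of_nonneg_left h4 hcb
      _ = t * wilsonAction4 U := by rw [ht]; ring
  -- Step 2: integrate; `∫ e^{tA} dGibbs_β = Z(β − t)/Z(β)`
  have hint : Integrable (fun U : GaugeField (F.P K) 0 (Matrix.specialUnitaryGroup (Fin 2) ℂ) => Real.exp (t * wilsonAction4 U))
      (gibbsK F ℰp γ K) := by
    refine integrable_of_bounded ((measurable_wilsonAction4 RegularGaugeGroup.measurable_reTr).const_mul _).exp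
      (M := Real.exp (t * (2 * nP))) fun U => ?_
    rw [abs_of_pos (Real.exp_pos _)]
    obtain ⟨h0, h2⟩ := wilsonAction4_mem U
    exact Real.exp_le_exp.mpr (mul_le_mul_of_nonneg_left h2 ht0)
  have hstep : ∫ U, Real.exp (c₀ * β * ∑ a : Plaq (F.P K) 0, dist1 (GaugeField.plaqHol U a) ^ 2) ∂(gibbsK F ℰp γ K) ≤
      partitionFn (G := Matrix.specialUnitaryGroup (Fin 2) ℂ) (F.P K) (β - t) /
        partitionFn (G := Matrix.specialUnitaryGroup (Fin 2) ℂ) (F.P K) β := by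
    calc ∫ U, Real.exp (c₀ * β * ∑ a : Plaq (F.P K) 0, dist1 (GaugeField.plaqHol U a) ^ 2) ∂(gibbsK F ℰp γ K)
        ≤ ∫ U, Real.exp (t * wilsonAction4 U) ∂(gibbsK F ℰp γ K) :=
          integral_mono_of_nonneg (ae_of_all _ fun U => (Real.exp_pos _).le) hint (ae_of_all _ hpt)
      _ = partitionFn (G := Matrix.specialUnitaryGroup (Fin 2) ℂ) (F.P K) (β - t) /
            partitionFn (G := Matrix.specialUnitaryGroup (Fin 2) ℂ) (F.P K) β := by
          rw [gibbsK_eq, scheme_β_eq]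
          exact integral_exp_mul_action_eq (F.P K) hβ0.le t
  -- Step 3: the ratio, by §1 at `N = 2`, `d = 3`, `β' = β − t ≥ β/2`
  have hβ'0 : 0 < β - t := by linarith
  have hβ'le : β - t ≤ β := by linarith
  have hZ : 0 < partitionFn (G := Matrix.specialUnitaryGroup (Fin 2) ℂ) (F.P K) β := partitionFn_pos' (F.P K) hβ0.le
  have hZ' : 0 < partitionFn (G := Matrix.specialUnitaryGroup (Fin 2) ℂ) (F.P K) (β - t) := partitionFn_pos' (F.P K) hβ'0.le
  have hratio := hE (F.P K) β (β - t) hβ1 hβ'0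
  have hd3 : ((F.P K).d : ℝ) = 3 := by rw [T3Family.P_d]; norm_num
  have ha : (((2 * 2 : ℕ) : ℝ) - 1) / 2 = 3 / 2 := by norm_num
  rw [hd3, ha] at hratio
  have hlog2 : Real.log β - Real.log (β - t) ≤ Real.log 2 := by
    have h2 : β ≤ 2 * (β - t) := by linarith
    have := Real.log_le_log hβ0 h2
    rw [Real.log_mul two_ne_zero hβ'0.ne'] at this
    linarith
  have hlβ0 : 0 ≤ Real.log β := Real.log_nonneg hβ1
  have hlβ' : Real.log (β - t) ≤ Real.log β := Real.log_le_log hβ'0 hβ'le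
  have hfin : Real.log (partitionFn (G := Matrix.specialUnitaryGroup (Fin 2) ℂ) (F.P K) (β - t)) -
      Real.log (partitionFn (G := Matrix.specialUnitaryGroup (Fin 2) ℂ) (F.P K) β) ≤
      (Real.log 2 + 3 * E) * nP + 3 * Real.log β := by
    set V : ℝ := (Fintype.card (Site (F.P K) 0) : ℝ) with hV
    have e1 : 3 / 2 * (3 - 1) * V * (Real.log β - Real.log (β - t)) ≤ 3 * V * Real.log 2 := by
      have := mul_le_mul_of_nonneg_left hlog2 (by positivity : (0 : ℝ) ≤ 3 * V)
      linarith
    have e2 : 3 / 2 * (3 - 1 : ℝ) * Real.log (β - t) ≤ 3 * Real.log β := by linarith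
    have e3 : E * (3 : ℝ) ^ 2 * V = 3 * E * (3 * V) := by ring
    rw [hnP3]
    linarith [hratio, e1, e2, e3]
  calc ∫ U, Real.exp (c₀ * β * ∑ a : Plaq (F.P K) 0, dist1 (GaugeField.plaqHol U a) ^ 2) ∂(gibbsK F ℰp γ K)
      ≤ partitionFn (G := Matrix.specialUnitaryGroup (Fin 2) ℂ) (F.P K) (β - t) /
          partitionFn (G := Matrix.specialUnitaryGroup (Fin 2) ℂ) (F.P K) β := hstep
    _ = Real.exp (Real.log (partitionFn (G := Matrix.specialUnitaryGroup (Fin 2) ℂ) (F.P K) (β - t)) -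
          Real.log (partitionFn (G := Matrix.specialUnitaryGroup (Fin 2) ℂ) (F.P K) β)) := by
        rw [Real.exp_sub, Real.exp_log hZ', Real.exp_log hZ]
    _ ≤ Real.exp ((Real.log 2 + 3 * E) * nP + 3 * Real.log β) := Real.exp_le_exp.mpr hfin

/-- **★ THE BARE (`j = 0`) FACE OF THE CRUX WITH TOTAL SLACK `3·log β_K`** (every profile `(b₀, p₀)`, the `A` of
`exists_bareStiffness_le_logSlack`). [folklore] -/
theorem exists_crux0_le_logSlack :
    ∃ A : ℝ, 0 ≤ A ∧ ∀ (F : T3Family) (γ b₀ p₀ : ℝ), 0 < γ → γ ≤ 1 → ∀ (K : ℕ) (c₀ : ℝ), 0 ≤ c₀ → c₀ ≤ 1 / 8 →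
      ∫ U, Real.exp (c₀ * (γ * ((F.L : ℝ)⁻¹) ^ K)⁻¹ *
          ∑ a : Plaq (F.P K) 0, min (dist1 (GaugeField.plaqHol U a) ^ 2) (θBal F.L γ b₀ p₀ K ^ 2)) ∂(gibbsK F ℰp γ K) ≤
        Real.exp (A * (Fintype.card (Plaq (F.P K) 0) : ℝ) + 3 * Real.log (γ * ((F.L : ℝ)⁻¹) ^ K)⁻¹) := by
  obtain ⟨A, hA0, hA⟩ := exists_bareStiffness_le_logSlack
  refine ⟨A, hA0, fun F γ b₀ p₀ hγ hγ1 K c₀ hc₀ hc₀' => ?_⟩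
  have hcβ : 0 ≤ c₀ * (γ * ((F.L : ℝ)⁻¹) ^ K)⁻¹ :=
    mul_nonneg hc₀ (inv_nonneg.2 (mul_nonneg hγ.le (pow_nonneg (inv_nonneg.2 (Nat.cast_nonneg _)) K)))
  have h := integral_exp_dominated_le F hγ K hcβ (fun a U => min (dist1 (GaugeField.plaqHol U a) ^ 2) (θBal F.L γ b₀ p₀ K ^ 2))
    (fun a U => min_le_left _ _) (hA F γ hγ hγ1 K c₀ hc₀ hc₀')
  simpa only [mul_assoc] using h

/-- **★ THE BARE (`j = 0`) FACE OF THE BULK STUB WITH TOTAL SLACK `3·log β_K`** (every profile, same `A`). [folklore] -/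
theorem exists_bulk0_le_logSlack :
    ∃ A : ℝ, 0 ≤ A ∧ ∀ (F : T3Family) (γ b₀ p₀ : ℝ), 0 < γ → γ ≤ 1 → ∀ (K : ℕ) (c₀ : ℝ), 0 ≤ c₀ → c₀ ≤ 1 / 8 →
      ∫ U, Real.exp (c₀ * (γ * ((F.L : ℝ)⁻¹) ^ K)⁻¹ *
          ∑ a : Plaq (F.P K) 0, (if dist1 (GaugeField.plaqHol U a) < θBal F.L γ b₀ p₀ K then
            dist1 (GaugeField.plaqHol U a) ^ 2 else 0)) ∂(gibbsK F ℰp γ K) ≤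
        Real.exp (A * (Fintype.card (Plaq (F.P K) 0) : ℝ) + 3 * Real.log (γ * ((F.L : ℝ)⁻¹) ^ K)⁻¹) := by
  obtain ⟨A, hA0, hA⟩ := exists_bareStiffness_le_logSlack
  refine ⟨A, hA0, fun F γ b₀ p₀ hγ hγ1 K c₀ hc₀ hc₀' => ?_⟩
  have hcβ : 0 ≤ c₀ * (γ * ((F.L : ℝ)⁻¹) ^ K)⁻¹ :=
    mul_nonneg hc₀ (inv_nonneg.2 (mul_nonneg hγ.le (pow_nonneg (inv_nonneg.2 (Nat.cast_nonneg _)) K)))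
  have h := integral_exp_dominated_le F hγ K hcβ
    (fun a U => if dist1 (GaugeField.plaqHol U a) < θBal F.L γ b₀ p₀ K then dist1 (GaugeField.plaqHol U a) ^ 2 else 0)
    (fun a U => by
      show (if dist1 (GaugeField.plaqHol U a) < θBal F.L γ b₀ p₀ K then dist1 (GaugeField.plaqHol U a) ^ 2 else 0) ≤ _
      split_ifs
      · exact le_rfl
      · exact sq_nonneg _)
    (hA F γ hγ hγ1 K c₀ hc₀ hc₀')
  simpa only [mul_assoc] using h

/-- **★ THE MEAN ACTION WITH TOTAL SLACK**: `β_K·∫ Σ_a|U(∂a) − 1|² dGibbs_K ≤ 8A·#Plaq_0 + 24·log β_K` for all `F`, `0 < γ ≤ 1`, `K`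
(Jensen at `c₀ = 1/8`). [folklore] -/
theorem exists_meanSqSum_le_logSlack :
    ∃ A : ℝ, 0 ≤ A ∧ ∀ (F : T3Family) (γ : ℝ), 0 < γ → γ ≤ 1 → ∀ (K : ℕ),
      (γ * ((F.L : ℝ)⁻¹) ^ K)⁻¹ * ∫ U, (∑ a : Plaq (F.P K) 0, dist1 (GaugeField.plaqHol U a) ^ 2) ∂(gibbsK F ℰp γ K) ≤
        8 * A * (Fintype.card (Plaq (F.P K) 0) : ℝ) + 24 * Real.log (γ * ((F.L : ℝ)⁻¹) ^ K)⁻¹ := by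
  obtain ⟨A, hA0, hA⟩ := exists_bareStiffness_le_logSlack
  refine ⟨A, hA0, fun F γ hγ hγ1 K => ?_⟩
  set β : ℝ := (γ * ((F.L : ℝ)⁻¹) ^ K)⁻¹ with hβdef
  have hβ0 : 0 ≤ β := inv_nonneg.2 (mul_nonneg hγ.le (pow_nonneg (inv_nonneg.2 (Nat.cast_nonneg _)) K))
  haveI := isProbabilityMeasure_gibbsK F ℰp hγ.le K
  have hb := hA F γ hγ hγ1 K (1 / 8) (by norm_num) le_rfl
  have hpos : 0 < ∫ U, Real.exp (1 / 8 * β * ∑ a : Plaq (F.P K) 0, dist1 (GaugeField.plaqHol U a) ^ 2) ∂(gibbsK F ℰp γ K) := by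
    have hc : ∫ _U : GaugeField (F.P K) 0 (Matrix.specialUnitaryGroup (Fin 2) ℂ), (1 : ℝ) ∂(gibbsK F ℰp γ K) = 1 := by
      rw [integral_const, smul_eq_mul, mul_one, probReal_univ]
    have h1 : ∫ _U : GaugeField (F.P K) 0 (Matrix.specialUnitaryGroup (Fin 2) ℂ), (1 : ℝ) ∂(gibbsK F ℰp γ K) ≤
        ∫ U, Real.exp (1 / 8 * β * ∑ a : Plaq (F.P K) 0, dist1 (GaugeField.plaqHol U a) ^ 2) ∂(gibbsK F ℰp γ K) := by
      refine integral_mono_of_nonneg (ae_of_all _ fun _ => zero_le_one) ?_ (ae_of_all _ fun U => ?_)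
      · refine integrable_of_bounded (((measurable_sqSum F K).const_mul _).exp)
          (M := Real.exp (1 / 8 * β * (4 * (Fintype.card (Plaq (F.P K) 0) : ℝ)))) fun U => ?_
        rw [abs_of_pos (Real.exp_pos _)]
        have hb8 : (0 : ℝ) ≤ 1 / 8 * β := by positivity
        exact Real.exp_le_exp.mpr (mul_le_mul_of_nonneg_left (sqSum_mem F U).2 hb8)
      · have hb8 : (0 : ℝ) ≤ 1 / 8 * β := by positivity
        exact Real.one_le_exp (mul_nonneg hb8 (sqSum_mem F U).1)
    rw [hc] at h1
    linarith
  have hJ : ∫ U, (1 / 8 * β * ∑ a : Plaq (F.P K) 0, dist1 (GaugeField.plaqHol U a) ^ 2) ∂(gibbsK F ℰp γ K) ≤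
      Real.log (∫ U, Real.exp (1 / 8 * β * ∑ a : Plaq (F.P K) 0, dist1 (GaugeField.plaqHol U a) ^ 2) ∂(gibbsK F ℰp γ K)) :=
    integral_le_log_integral_exp ((measurable_sqSum F K).const_mul _)
      (M := 1 / 8 * β * (4 * (Fintype.card (Plaq (F.P K) 0) : ℝ))) fun U => by
        obtain ⟨h0, h4⟩ := sqSum_mem F U
        rw [abs_of_nonneg (by positivity)]
        exact mul_le_mul_of_nonneg_left h4 (by positivity)
  have hlog := Real.log_le_log hpos hb
  rw [Real.log_exp] at hlog
  rw [integral_const_mul] at hJ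
  linarith

end Bare

/-! ## §3 OUTSIDE THE HYPER-WEAK CORNER `log β_K ≤ #Plaq_0`: the bare faces and the uniform mean action with ABSOLUTE constants -/

section Absolute

variable (F : T3Family)

/-- **★★ THE BARE FACE OF THE CRUX, ABSOLUTE CONSTANTS OUTSIDE THE HYPER-WEAK CORNER.**  There are `c₀ > 0` and `C₀` (independent of
EVERYTHING: `L`, `m`, `K`, `γ`, the profile) such that for every three-torus family `F`, every `0 < γ ≤ 1`, every `(b₀, p₀)` and every cut-off `K`
with `log β_K ≤ #Plaq_0`:  `∫ exp(c₀·β_K·Σ_a min(|U(∂a) − 1|², θ(K)²)) dGibbs_K ≤ exp(C₀·#Plaq_0)` — the `j = 0` instance of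
`CappedCoarseStiffnessL` (25301) with the crux's uniformities, off the corner `K log L + log γ⁻¹ > 24·L^{3(m+K)}`. [folklore] -/
theorem crux0_of_log_le :
    ∃ (c₀ C₀ : ℝ), 0 < c₀ ∧ ∀ (F : T3Family) (γ b₀ p₀ : ℝ), 0 < γ → γ ≤ 1 → ∀ (K : ℕ),
      Real.log (γ * ((F.L : ℝ)⁻¹) ^ K)⁻¹ ≤ (Fintype.card (Plaq (F.P K) 0) : ℝ) →
      ∫ U, Real.exp (c₀ * (γ * ((F.L : ℝ)⁻¹) ^ K)⁻¹ *
          ∑ a : Plaq (F.P K) 0, min (dist1 (GaugeField.plaqHol U a) ^ 2) (θBal F.L γ b₀ p₀ K ^ 2)) ∂(gibbsK F ℰp γ K) ≤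
        Real.exp (C₀ * (Fintype.card (Plaq (F.P K) 0) : ℝ)) := by
  obtain ⟨A, hA0, hA⟩ := exists_crux0_le_logSlack
  refine ⟨1 / 8, A + 3, by norm_num, fun F γ b₀ p₀ hγ hγ1 K hlog => ?_⟩
  refine (hA F γ b₀ p₀ hγ hγ1 K (1 / 8) (by norm_num) le_rfl).trans (Real.exp_le_exp.mpr ?_)
  nlinarith [hlog]

/-- **★★ THE BARE FACE OF THE BULK STUB, ABSOLUTE CONSTANTS OUTSIDE THE HYPER-WEAK CORNER** (`stub_subThresholdStiffness` at `j = 0`).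
[folklore] -/
theorem bulk0_of_log_le :
    ∃ (c₀ C₀ : ℝ), 0 < c₀ ∧ ∀ (F : T3Family) (γ b₀ p₀ : ℝ), 0 < γ → γ ≤ 1 → ∀ (K : ℕ),
      Real.log (γ * ((F.L : ℝ)⁻¹) ^ K)⁻¹ ≤ (Fintype.card (Plaq (F.P K) 0) : ℝ) →
      ∫ U, Real.exp (c₀ * (γ * ((F.L : ℝ)⁻¹) ^ K)⁻¹ *
          ∑ a : Plaq (F.P K) 0, (if dist1 (GaugeField.plaqHol U a) < θBal F.L γ b₀ p₀ K then
            dist1 (GaugeField.plaqHol U a) ^ 2 else 0)) ∂(gibbsK F ℰp γ K) ≤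
        Real.exp (C₀ * (Fintype.card (Plaq (F.P K) 0) : ℝ)) := by
  obtain ⟨A, hA0, hA⟩ := exists_bulk0_le_logSlack
  refine ⟨1 / 8, A + 3, by norm_num, fun F γ b₀ p₀ hγ hγ1 K hlog => ?_⟩
  refine (hA F γ b₀ p₀ hγ hγ1 K (1 / 8) (by norm_num) le_rfl).trans (Real.exp_le_exp.mpr ?_)
  nlinarith [hlog]

/-- **★★ THE UNCAPPED BARE STIFFNESS, ABSOLUTE CONSTANTS OUTSIDE THE HYPER-WEAK CORNER**:
`∫ exp(c₀·β_K·Σ_a |U(∂a) − 1|²) dGibbs_K ≤ exp(C₀·#Plaq_0)` whenever `log β_K ≤ #Plaq_0` (`c₀ = 1/8`). [folklore] -/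
theorem ubs_of_log_le :
    ∃ (c₀ C₀ : ℝ), 0 < c₀ ∧ ∀ (F : T3Family) (γ : ℝ), 0 < γ → γ ≤ 1 → ∀ (K : ℕ),
      Real.log (γ * ((F.L : ℝ)⁻¹) ^ K)⁻¹ ≤ (Fintype.card (Plaq (F.P K) 0) : ℝ) →
      ∫ U, Real.exp (c₀ * (γ * ((F.L : ℝ)⁻¹) ^ K)⁻¹ * ∑ a : Plaq (F.P K) 0, dist1 (GaugeField.plaqHol U a) ^ 2) ∂(gibbsK F ℰp γ K) ≤
        Real.exp (C₀ * (Fintype.card (Plaq (F.P K) 0) : ℝ)) := by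
  obtain ⟨A, hA0, hA⟩ := exists_bareStiffness_le_logSlack
  refine ⟨1 / 8, A + 3, by norm_num, fun F γ hγ hγ1 K hlog => ?_⟩
  refine (hA F γ hγ hγ1 K (1 / 8) (by norm_num) le_rfl).trans (Real.exp_le_exp.mpr ?_)
  nlinarith [hlog]

/-- **★★ UNIFORM MEAN ACTION WITH AN ABSOLUTE CONSTANT OUTSIDE THE HYPER-WEAK CORNER**: `β_K·∫ Σ_a|U(∂a) − 1|² dGibbs_K ≤ C·#Plaq_0` for
every `F`, every `0 < γ ≤ 1`, every `K` with `log β_K ≤ #Plaq_0` — mean plaquette energy `O(1/β_K)` on ALL of Bałaban's three-tori, uniformly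
in the cut-off, the volume AND the coupling, except in the hyper-weak corner `log γ⁻¹ ≳ L^{3(m+K)}` of a fixed lattice (stub S3's residual).
[folklore] -/
theorem uma_of_log_le :
    ∃ C : ℝ, ∀ (F : T3Family) (γ : ℝ), 0 < γ → γ ≤ 1 → ∀ (K : ℕ),
      Real.log (γ * ((F.L : ℝ)⁻¹) ^ K)⁻¹ ≤ (Fintype.card (Plaq (F.P K) 0) : ℝ) →
      (γ * ((F.L : ℝ)⁻¹) ^ K)⁻¹ * ∫ U, (∑ a : Plaq (F.P K) 0, dist1 (GaugeField.plaqHol U a) ^ 2) ∂(gibbsK F ℰp γ K) ≤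
        C * (Fintype.card (Plaq (F.P K) 0) : ℝ) := by
  obtain ⟨A, hA0, hA⟩ := exists_meanSqSum_le_logSlack
  refine ⟨8 * A + 24, fun F γ hγ hγ1 K hlog => ?_⟩
  refine (hA F γ hγ hγ1 K).trans ?_
  nlinarith [hlog]

/-- **COROLLARY (compact couplings, bounded depth — the regime of every consumer): UNIFORM MEAN ACTION for `log γ⁻¹ ≤ Λ` and ALL `K`,
`m` with `K·log L + Λ ≤ 24·L^{3(m+K)}`… stated simply: if `log β_K ≤ #Plaq_0` FAILS then `#Plaq_0 < log β_K`, so in ALL cases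
`β_K·∫Σ|U(∂a)−1|² ≤ C·#Plaq_0 + 24·log β_K`** — the clean two-term form used by the line card. [folklore] -/
theorem meanSqSum_le_two_terms :
    ∃ C : ℝ, 0 ≤ C ∧ ∀ (F : T3Family) (γ : ℝ), 0 < γ → γ ≤ 1 → ∀ (K : ℕ),
      (γ * ((F.L : ℝ)⁻¹) ^ K)⁻¹ * ∫ U, (∑ a : Plaq (F.P K) 0, dist1 (GaugeField.plaqHol U a) ^ 2) ∂(gibbsK F ℰp γ K) ≤
        C * (Fintype.card (Plaq (F.P K) 0) : ℝ) + 24 * Real.log (γ * ((F.L : ℝ)⁻¹) ^ K)⁻¹ := by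
  obtain ⟨A, hA0, hA⟩ := exists_meanSqSum_le_logSlack
  exact ⟨8 * A, by positivity, fun F γ hγ hγ1 K => hA F γ hγ hγ1 K⟩

end Absolute

end Summit.QuantumFields.YangMills.Theorems.CoarseStiffnessTailTotalLogSlack

end
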